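import Literature.MathematicalPhysics.KineticTheory.CollisionFluxMeanBound
import Summits.AtomisticToContinuum.HydrodynamicLimit.Theorems.SpeedCapSurgeryMaxSpeedBoundLogEnergeticCountTools
import Summits.AtomisticToContinuum.HydrodynamicLimit.Theorems.OneFlightGossipEngineEnergyCurrentTailsLevelCensusEventMeasurable
import HarnessLib

/-!
# Energetic collisions along a NON-stationary law: reduction to fixed-time one-window bounds

Helper file of the crux line `registered` (birth skeleton) of `SpeedCapSurgery.MaxSpeedBoundLog`
(stmt-AtomisticToContinuum-9629), `--supports` that item. The dynamic stub of the line,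
`stub_energeticCollisionsRare` ("the number of collision times in `(0,t]` whose colliding pair has
kinetic energy above `C² log(N+2)` has a measurable count-majorant of vanishing local-Gibbs mean"),
was proved in cycle 1 under the flow-INVARIANT homogeneous Gibbs law
(`equilibrium_energeticCollisionsRare`, via the tree's mean collision-flux bound
`localGibbsLaw_lintegral_le_of_le_collisionMarkSum`, whose hypothesis `hstat` is stationarity). The
local Gibbs law of non-constant profiles is NOT invariant. This file records what the same
Cercignani–Illner–Pulvirenti window argument gives WITHOUT stationarity, for an arbitrary law `P`
carried by the good set of the flow:

* `lintegral_le_liminf_sum_of_le_collisionSum` (abstract geometry and law): every `f ≥ 0` dominated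
  on the good set by a collision sum over `[0, τ]` has
  `∫ f dP ≤ liminf_M Σ_{k=1}^{M} ∫ W_M (Φ_{kτ/M} z) dP(z)` — a time-Riemann sum of the means, under
  the FIXED-TIME laws `P ∘ Φ_{kτ/M}⁻¹`, of the one-window functional `W_M` (pathwise grid bound
  `sum_collision_le_sum_window` below the gap of the collision times, Fatou; the stationary lemma of
  the Literature is the special case in which every summand equals `∫ W_M dP`);
  `lintegral_le_liminf_sum_map_of_le_collisionSum` is the same bound written with the push-forward
  laws;
* `lintegral_indicator_eventSum_le_liminf_windowSum` (the crux frame, ANY profiles): the local-Gibbs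
  mean of the good-set-extended energetic velocity-event count `eventSum Φ 0 t {c² < ‖v₁⁺‖²+‖v₂⁺‖²}`
  is at most the time-Riemann sum of the fixed-time local-Gibbs probabilities-with-multiplicity of
  the one-window energetic pair events "some lift of `xᵢ − xⱼ` lies in the swept tube
  `S_M (vⱼ − vᵢ)` and `c² < ‖vᵢ‖² + ‖vⱼ‖²`", for every tube family `S_M` with the covering property
  of `exists_sweptTube` at window length `t/M`;
* `energeticCollisionsRare_data_of_windowBound` (THE REDUCTION): hence the data demanded by
  `stub_energeticCollisionsRare` at `(σ, t, Φ)` — `C ≥ 0`, measurable majorants `g N`, `∫ g N → 0` —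
  follow from the vanishing, as `N → ∞`, of those time-Riemann sums at level `c = C √log(N+2)`
  (`g N = 𝟙_good · eventSum`, measurable by `censusLedger_eventMeasurable`, a majorant by
  `ncard_energetic_le_eventSum`); `liminf_sum_le_of_forall_le_div` is the bookkeeping for a bound
  uniform over the grid times.

So the open content of the stub, in either frame (all `t ≥ 0` as registered, or pre-shock as
recommended), is a statement about the ONE-TIME laws `LG_N ∘ Φ_s⁻¹`, `s ≤ t`, on TWO-BODY events of
Liouville size `≍ ε² (t/M) ‖vᵢ − vⱼ‖ 𝟙{energetic}`: no path-space or collision-count object remains.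

References: C. Cercignani, R. Illner, M. Pulvirenti, *The Mathematical Theory of Dilute Gases*
(1994), App. 4.A; I. Gallagher, L. Saint-Raymond, B. Texier, *From Newton to Boltzmann* (2013),
Prop. 4.1.1.
-/

noncomputable section

open MeasureTheory ProbabilityTheory Set Filter Topology
open scoped ENNReal InnerProductSpace BigOperators

namespace Summit.AtomisticToContinuum.HydrodynamicLimit.Theorems.MaxSpeedBoundLogLine

open Literature.MathematicalPhysics.KineticTheory Literature.Analysis.FluidPDE Literature.Analysis.FunctionSpaces
open Summit.AtomisticToContinuum.HydrodynamicLimit.Theorems.EnergyCurrentTailsLevelCensus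

/-! ## The mean of a collision sum under an arbitrary law carried by the good set -/

/-- **Functionals dominated by a collision sum: the non-stationary window bound (abstract form).**
For a hard-sphere flow `Φ`, a law `P` carried by the good set (no invariance assumed), `τ > 0`, a
mark `F ≥ 0`, measurable window events `E M i j ⊇ {(i,j) reaches contact under a backward free
flight of duration ≤ τ/M}` and measurable majorants `Ft M ≥ F` along those flights, every `f ≥ 0`
dominated on the good set by the collision sum
`Σ_{collision times s ∈ [0,τ]} Σ_{ordered contact pairs (i,j)} F(Φ_s z, i, j)` has
`∫ f dP ≤ liminf_M Σ_{k=1}^{M} ∫ Σ_{i≠j} 𝟙_{E M i j}(Φ_{kτ/M} z) F̃ M (Φ_{kτ/M} z, i, j) dP(z)`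
(pathwise grid bound below the gap of the collision times, Fatou). Cercignani–Illner–Pulvirenti
1994 App. 4.A without the stationarity step. -/
theorem lintegral_le_liminf_sum_of_le_collisionSum {d X : Type*} [Fintype d] [MeasureSpace X]
    [TopologicalSpace X] {G : Geometry d X} {ε : ℝ} {n : ℕ} (Φ : HardSphereFlow G ε n)
    (P : Measure (Config n d X)) (hP : P Φ.goodᶜ = 0) {τ : ℝ} (hτ : 0 < τ)
    (F : Config n d X → Fin n → Fin n → ℝ≥0∞)
    (E : ℕ → Fin n → Fin n → Set (Config n d X)) (hEm : ∀ M i j, MeasurableSet (E M i j))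
    (hE : ∀ (M : ℕ) (i j : Fin n), i ≠ j → ∀ w ∈ hardSphereDomain G n ε, ∀ t ∈ Icc 0 (τ / M),
      ‖G.sepVec ((freeFlight G (-t) w i).1) ((freeFlight G (-t) w j).1)‖ = ε → w ∈ E M i j)
    (Ft : ℕ → Config n d X → Fin n → Fin n → ℝ≥0∞) (hFtm : ∀ M i j, Measurable fun w => Ft M w i j)
    (hFt : ∀ (M : ℕ) (i j : Fin n), i ≠ j → ∀ w ∈ hardSphereDomain G n ε, ∀ t ∈ Icc 0 (τ / M),
      ‖G.sepVec ((freeFlight G (-t) w i).1) ((freeFlight G (-t) w j).1)‖ = ε →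
        F (freeFlight G (-t) w) i j ≤ Ft M w i j)
    (f : Config n d X → ℝ≥0∞)
    (hf : ∀ z ∈ Φ.good, f z ≤ ∑ᶠ s ∈ collisionTimes G ε (fun t => Φ.flow t z) ∩ Icc 0 τ,
        ∑ i, ∑ j, (if i ≠ j ∧ ‖G.sepVec (Φ.flow s z i).1 (Φ.flow s z j).1‖ = ε
          then F (Φ.flow s z) i j else 0)) :
    ∫⁻ z, f z ∂P ≤
      liminf (fun M : ℕ => ∑ k ∈ Finset.Icc 1 M,
        ∫⁻ z, (∑ i, ∑ j, (if i ≠ j then (E M i j).indicator (fun w => Ft M w i j)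
          (Φ.flow ((k : ℝ) * (τ / M)) z) else 0)) ∂P) atTop := by
  classical
  -- adapted from `lintegral_le_liminf_of_le_collisionSum` (`CollisionFluxMeanBound`), steps (i), (iii)
  set W : ℕ → Config n d X → ℝ≥0∞ := fun M w => ∑ i, ∑ j,
    (if i ≠ j then (E M i j).indicator (fun w => Ft M w i j) w else 0) with hWdef
  have hWm : ∀ M, Measurable (W M) := by
    intro M
    refine Finset.measurable_sum _ fun i _ => Finset.measurable_sum _ fun j _ => ?_
    by_cases hij : i ≠ j
    · simp only [if_pos hij]
      exact (hFtm M i j).indicator (hEm M i j)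
    · simp only [if_neg hij]
      exact measurable_const
  set SM : ℕ → Config n d X → ℝ≥0∞ := fun M z =>
    ∑ k ∈ Finset.Icc 1 M, W M (Φ.flow ((k : ℝ) * (τ / M)) z) with hSMdef
  have hSMm : ∀ M, Measurable (SM M) := fun M =>
    Finset.measurable_sum _ fun k _ => (hWm M).comp (Φ.measurable_flow _)
  set Kstar : Config n d X → ℝ≥0∞ := fun z => liminf (fun M => SM M z) atTop with hKdef
  -- (i) the pathwise bound on the good set, hence `f ≤ Kstar` almost everywhere
  have hpath : ∀ z ∈ Φ.good, f z ≤ Kstar z := by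
    intro z hz
    refine (hf z hz).trans ?_
    have hγ := Φ.isTrajectory z hz
    have hfin := hγ.locFinite 0 τ
    rw [finsum_mem_eq_finite_toFinset_sum _ hfin]
    obtain ⟨g, hg, hgap⟩ := exists_gap_of_finite hfin
    show _ ≤ liminf (fun M => SM M z) atTop
    refine le_liminf_of_le (h := ?_)
    filter_upwards [eventually_gt_atTop ⌈τ / g⌉₊] with M hM
    have hM0 : 0 < M := lt_of_le_of_lt (Nat.zero_le _) hM
    have hMg : τ / M < g := by
      have h1 : τ / g < M := (Nat.le_ceil _).trans_lt (by exact_mod_cast hM)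
      rw [div_lt_iff₀ hg] at h1
      rw [div_lt_iff₀ (by exact_mod_cast hM0)]
      linarith
    have hgap' : ∀ s ∈ collisionTimes G ε (fun t => Φ.flow t z) ∩ Icc 0 τ,
        ∀ s' ∈ collisionTimes G ε (fun t => Φ.flow t z) ∩ Icc 0 τ, s < s' → τ / M < s' - s :=
      fun s hs s' hs' hlt => hMg.trans_le (hgap s hs s' hs' hlt)
    exact sum_collision_le_sum_window hγ hτ hM0 hgap' (E M) (hE M) F (Ft M) (hFt M)
  have hae : ∀ᵐ z ∂P, f z ≤ Kstar z := by
    have h : ∀ᵐ z ∂P, z ∈ Φ.good := by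
      rw [ae_iff]
      exact hP
    filter_upwards [h] with z hz using hpath z hz
  -- (ii) the mean of each grid sum is the sum of the means (no stationarity)
  have hmeanM : ∀ M, ∫⁻ z, SM M z ∂P =
      ∑ k ∈ Finset.Icc 1 M, ∫⁻ z, W M (Φ.flow ((k : ℝ) * (τ / M)) z) ∂P :=
    fun M => lintegral_finsetSum _ fun k _ => (hWm M).comp (Φ.measurable_flow _)
  -- (iii) Fatou
  calc ∫⁻ z, f z ∂P ≤ ∫⁻ z, Kstar z ∂P := lintegral_mono_ae hae
    _ ≤ liminf (fun M : ℕ => ∫⁻ z, SM M z ∂P) atTop := lintegral_liminf_le hSMm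
    _ = liminf (fun M : ℕ => ∑ k ∈ Finset.Icc 1 M,
          ∫⁻ z, W M (Φ.flow ((k : ℝ) * (τ / M)) z) ∂P) atTop :=
        congrArg (fun u : ℕ → ℝ≥0∞ => liminf u atTop) (funext hmeanM)

/-- **The same bound with the push-forward (fixed-time) laws**: under the hypotheses of
`lintegral_le_liminf_sum_of_le_collisionSum`,
`∫ f dP ≤ liminf_M Σ_{k=1}^{M} ∫ W_M d(P ∘ Φ_{kτ/M}⁻¹)` — each summand is the mean of the one-window
functional under the LAW AT TIME `kτ/M` (`HardSphereFlow.lawAt`). -/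
theorem lintegral_le_liminf_sum_map_of_le_collisionSum {d X : Type*} [Fintype d] [MeasureSpace X]
    [TopologicalSpace X] {G : Geometry d X} {ε : ℝ} {n : ℕ} (Φ : HardSphereFlow G ε n)
    (P : Measure (Config n d X)) (hP : P Φ.goodᶜ = 0) {τ : ℝ} (hτ : 0 < τ)
    (F : Config n d X → Fin n → Fin n → ℝ≥0∞)
    (E : ℕ → Fin n → Fin n → Set (Config n d X)) (hEm : ∀ M i j, MeasurableSet (E M i j))
    (hE : ∀ (M : ℕ) (i j : Fin n), i ≠ j → ∀ w ∈ hardSphereDomain G n ε, ∀ t ∈ Icc 0 (τ / M),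
      ‖G.sepVec ((freeFlight G (-t) w i).1) ((freeFlight G (-t) w j).1)‖ = ε → w ∈ E M i j)
    (Ft : ℕ → Config n d X → Fin n → Fin n → ℝ≥0∞) (hFtm : ∀ M i j, Measurable fun w => Ft M w i j)
    (hFt : ∀ (M : ℕ) (i j : Fin n), i ≠ j → ∀ w ∈ hardSphereDomain G n ε, ∀ t ∈ Icc 0 (τ / M),
      ‖G.sepVec ((freeFlight G (-t) w i).1) ((freeFlight G (-t) w j).1)‖ = ε →
        F (freeFlight G (-t) w) i j ≤ Ft M w i j)
    (f : Config n d X → ℝ≥0∞)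
    (hf : ∀ z ∈ Φ.good, f z ≤ ∑ᶠ s ∈ collisionTimes G ε (fun t => Φ.flow t z) ∩ Icc 0 τ,
        ∑ i, ∑ j, (if i ≠ j ∧ ‖G.sepVec (Φ.flow s z i).1 (Φ.flow s z j).1‖ = ε
          then F (Φ.flow s z) i j else 0)) :
    ∫⁻ z, f z ∂P ≤
      liminf (fun M : ℕ => ∑ k ∈ Finset.Icc 1 M,
        ∫⁻ w, (∑ i, ∑ j, (if i ≠ j then (E M i j).indicator (fun w => Ft M w i j) w else 0))
          ∂(Φ.lawAt P ((k : ℝ) * (τ / M)))) atTop := by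
  classical
  have hWm : ∀ M, Measurable fun w : Config n d X => ∑ i, ∑ j,
      (if i ≠ j then (E M i j).indicator (fun w => Ft M w i j) w else 0) := by
    intro M
    refine Finset.measurable_sum _ fun i _ => Finset.measurable_sum _ fun j _ => ?_
    by_cases hij : i ≠ j
    · simp only [if_pos hij]
      exact (hFtm M i j).indicator (hEm M i j)
    · simp only [if_neg hij]
      exact measurable_const
  have h := lintegral_le_liminf_sum_of_le_collisionSum Φ P hP hτ F E hEm hE Ft hFtm hFt f hf
  refine h.trans_eq (congrArg (fun u : ℕ → ℝ≥0∞ => liminf u atTop) (funext fun M => ?_))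
  refine Finset.sum_congr rfl fun k _ => ?_
  rw [HardSphereFlow.lawAt_eq, lintegral_map (hWm M) (Φ.measurable_flow _)]

/-- Bookkeeping: a bound `B / M` on each of the `M` grid terms bounds the `liminf` of the
time-Riemann sums by `B`. -/
theorem liminf_sum_le_of_forall_le_div {a : ℕ → ℕ → ℝ≥0∞} {B : ℝ≥0∞}
    (h : ∀ M : ℕ, 1 ≤ M → ∀ k ∈ Finset.Icc 1 M, a M k ≤ B / M) :
    liminf (fun M : ℕ => ∑ k ∈ Finset.Icc 1 M, a M k) atTop ≤ B := by
  refine Filter.liminf_le_of_frequently_le' (Filter.Eventually.frequently ?_)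
  filter_upwards [eventually_ge_atTop 1] with M hM
  have hM0 : (M : ℝ≥0∞) ≠ 0 := by exact_mod_cast Nat.one_le_iff_ne_zero.mp hM
  calc ∑ k ∈ Finset.Icc 1 M, a M k ≤ ∑ _k ∈ Finset.Icc 1 M, B / M := Finset.sum_le_sum (h M hM)
    _ = (M : ℝ≥0∞) * (B / M) := by
        rw [Finset.sum_const, Nat.card_Icc, Nat.add_sub_cancel, nsmul_eq_mul]
    _ = B := ENNReal.mul_div_cancel hM0 (ENNReal.natCast_ne_top M)

/-! ## The crux frame: energetic collisions under the local Gibbs law of ANY profiles -/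

/-- **The local-Gibbs mean of the energetic velocity-event count is bounded by time-Riemann sums of
fixed-time one-window energetic pair events (any profiles, no stationarity).** For `σ > 0`,
profiles `a₀, u₀, θ₀` (arbitrary: only `localGibbsLaw ≪ liouville` is used), a flow `Φ` of the crux
frame, `t > 0`, a level `c`, and tube families `S M` (measurable graph; every relative position at
distance `≥ ε` brought to the contact sphere by a straight flight of duration `≤ t/M` at relative
velocity `u` lies in `S M u` — e.g. the swept tubes of `exists_sweptTube`, of volume
`≤ 4 ε² (t/M) ‖u‖`): the mean of `𝟙_good · eventSum Φ 0 t {c² < ‖v₁⁺‖² + ‖v₂⁺‖²}` is at most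
`liminf_M Σ_{k=1}^{M} ∫ Σ_{i≠j} 𝟙{some lift of xᵢ − xⱼ ∈ S M (vⱼ − vᵢ)} 𝟙{c² < ‖vᵢ‖² + ‖vⱼ‖²}
(Φ_{kt/M} z) dLG(z)` — each summand a FIXED-TIME, TWO-BODY local-Gibbs expectation. -/
theorem lintegral_indicator_eventSum_le_liminf_windowSum {σ : ℝ} (hσ : 0 < σ)
    (a₀ θ₀ : T3 → ℝ) (u₀ : T3 → V3) {N : ℕ} (Φ : Flow σ N) {t : ℝ} (ht : 0 < t) (c : ℝ)
    (S : ℕ → V3 → Set V3) (hSm : ∀ M, MeasurableSet {q : V3 × V3 | q.1 ∈ S M q.2})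
    (hS : ∀ (M : ℕ) (u r : V3) (s : ℝ), hsDiameter σ N ≤ ‖r‖ → s ∈ Icc 0 (t / M) →
      ‖r + s • u‖ = hsDiameter σ N → r ∈ S M u) :
    ∫⁻ z, Φ.good.indicator (eventSum Φ 0 t {q : VelEvent | c ^ 2 < ‖q.2.1‖ ^ 2 + ‖q.2.2‖ ^ 2}) z
        ∂(localGibbsLaw σ a₀ u₀ θ₀ N Φ) ≤
      liminf (fun M : ℕ => ∑ k ∈ Finset.Icc 1 M,
        ∫⁻ z, (∑ i : Fin (N + 1), ∑ j : Fin (N + 1), (if i ≠ j then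
          {w : Config (N + 1) (Fin 3) T3 | ∃ k : Fin 3 → ℤ,
              Torus.reprSym ((w i).1 - (w j).1) + Torus.latticeVec k ∈ S M ((w j).2 - (w i).2)}.indicator
            (fun w => Set.indicator {p : V3 × V3 | c ^ 2 < ‖p.1‖ ^ 2 + ‖p.2‖ ^ 2}
              (fun _ => (1 : ℝ≥0∞)) ((w i).2, (w j).2))
            (Φ.flow ((k : ℝ) * (t / M)) z) else 0)) ∂(localGibbsLaw σ a₀ u₀ θ₀ N Φ)) atTop := by
  classical
  set ε := hsDiameter σ N with hεdef
  set P := localGibbsLaw σ a₀ u₀ θ₀ N Φ with hPdef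
  have hP : P Φ.goodᶜ = 0 := by
    rw [hPdef]
    exact MeasureTheory.withDensity_absolutelyContinuous _ _ Φ.measure_compl_good
  -- the mark: indicator of the energetic pair, a function of the two velocities
  set b : V3 × V3 → ℝ≥0∞ :=
    Set.indicator {p : V3 × V3 | c ^ 2 < ‖p.1‖ ^ 2 + ‖p.2‖ ^ 2} (fun _ => (1 : ℝ≥0∞)) with hbdef
  have hbm : Measurable b :=
    measurable_const.indicator (measurableSet_lt measurable_const (by fun_prop))
  set F : Config (N + 1) (Fin 3) T3 → Fin (N + 1) → Fin (N + 1) → ℝ≥0∞ :=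
    fun w i j => b ((w i).2, (w j).2) with hFdef
  have hFm : ∀ i j, Measurable fun w => F w i j :=
    fun i j => hbm.comp ((measurable_pi_apply i).snd.prodMk (measurable_pi_apply j).snd)
  have hFfree : ∀ (s : ℝ) (w : Config (N + 1) (Fin 3) T3) (i j : Fin (N + 1)),
      F (freeFlight (Torus.geometry (Fin 3)) (-s) w) i j = F w i j := by
    intro s w i j
    simp only [hFdef, freeFlight_apply]
  -- the window events: some lift of the relative position lies in the tube of the relative velocity
  set E : ℕ → Fin (N + 1) → Fin (N + 1) → Set (Config (N + 1) (Fin 3) T3) := fun M i j =>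
    {w | ∃ k : Fin 3 → ℤ, Torus.reprSym ((w i).1 - (w j).1) + Torus.latticeVec k ∈ S M ((w j).2 - (w i).2)}
    with hEdef
  have hEm : ∀ M i j, MeasurableSet (E M i j) := by
    intro M i j
    set ψ : (Fin 3 → ℤ) → Config (N + 1) (Fin 3) T3 → V3 × V3 := fun k w =>
      (Torus.reprSym ((w i).1 - (w j).1) + Torus.latticeVec k, (w j).2 - (w i).2) with hψ
    have hψm : ∀ k, Measurable (ψ k) := by
      intro k
      refine Measurable.prodMk ?_ ?_
      · exact (Torus.measurable_reprSym.comp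
          ((measurable_pi_apply i).fst.sub (measurable_pi_apply j).fst)).add_const _
      · exact (measurable_pi_apply j).snd.sub (measurable_pi_apply i).snd
    have hE' : E M i j = ⋃ k, ψ k ⁻¹' {q : V3 × V3 | q.1 ∈ S M q.2} := by
      ext w
      simp only [hEdef, hψ, mem_setOf_eq, mem_iUnion, mem_preimage]
    rw [hE']
    exact MeasurableSet.iUnion fun k => (hSm M).preimage (hψm k)
  have hE : ∀ (M : ℕ) (i j : Fin (N + 1)), i ≠ j →
      ∀ w ∈ hardSphereDomain (Torus.geometry (Fin 3)) (N + 1) ε, ∀ s ∈ Icc 0 (t / M),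
      ‖(Torus.geometry (Fin 3)).sepVec ((freeFlight (Torus.geometry (Fin 3)) (-s) w i).1)
        ((freeFlight (Torus.geometry (Fin 3)) (-s) w j).1)‖ = ε → w ∈ E M i j :=
    fun M i j hij w hw s hs hc => exists_latticeVec_add_mem_of_contact (hS M) hw hij hs hc
  have hgen := lintegral_le_liminf_sum_of_le_collisionSum Φ P hP ht F E hEm hE (fun _ => F)
    (fun _ i j => hFm i j) (fun M i j _ w _ s _ _ => (hFfree s w i j).le)
    (Φ.good.indicator (eventSum Φ 0 t {q : VelEvent | c ^ 2 < ‖q.2.1‖ ^ 2 + ‖q.2.2‖ ^ 2})) ?_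
  · exact hgen
  · intro z hz
    rw [indicator_of_mem hz]
    exact eventSum_le_markSum hσ Φ hz c t

/-- **THE REDUCTION: the data of `stub_energeticCollisionsRare` at `(σ, t, Φ)` from vanishing
time-Riemann sums of fixed-time one-window energetic pair events.** For `0 < σ < 1/2`, ANY profiles,
`t > 0`, a flow family `Φ`, a constant `C ≥ 0` and, for every `N`, tube families `S N M` with the
covering property at window length `t/M` (e.g. `exists_sweptTube`): if the time-Riemann sums of the
local-Gibbs means of the one-window energetic pair functionals at level `c_N = C √log(N+2)` have
`liminf_M ≤ B N` with `B N → 0`, then there are measurable majorants `g N` of the number of collision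
times in `(0,t]` whose colliding pair has kinetic energy above `C² log(N+2)`, on good orbits, with
`∫ g N d(localGibbsLaw) → 0` — the conclusion of the registered dynamic stub at `(σ, t, Φ)`, in any
frame. (`g N = 𝟙_good · eventSum`: measurable by `censusLedger_eventMeasurable`, a majorant by
`ncard_energetic_le_eventSum`, small in the mean by `lintegral_indicator_eventSum_le_liminf_windowSum`.) -/
theorem energeticCollisionsRare_data_of_windowBound {σ : ℝ} (hσ : 0 < σ) (hσ2 : σ < 1 / 2)
    (a₀ θ₀ : T3 → ℝ) (u₀ : T3 → V3) {t : ℝ} (ht : 0 < t) (Φ : (N : ℕ) → Flow σ N)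
    {C : ℝ} (hC : 0 ≤ C)
    (S : ℕ → ℕ → V3 → Set V3) (hSm : ∀ N M, MeasurableSet {q : V3 × V3 | q.1 ∈ S N M q.2})
    (hS : ∀ (N M : ℕ) (u r : V3) (s : ℝ), hsDiameter σ N ≤ ‖r‖ → s ∈ Icc 0 (t / M) →
      ‖r + s • u‖ = hsDiameter σ N → r ∈ S N M u)
    (B : ℕ → ℝ≥0∞) (hB : Tendsto B atTop (𝓝 0))
    (hwin : ∀ N : ℕ, liminf (fun M : ℕ => ∑ k ∈ Finset.Icc 1 M,
        ∫⁻ z, (∑ i : Fin (N + 1), ∑ j : Fin (N + 1), (if i ≠ j then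
          {w : Config (N + 1) (Fin 3) T3 | ∃ k : Fin 3 → ℤ,
              Torus.reprSym ((w i).1 - (w j).1) + Torus.latticeVec k ∈ S N M ((w j).2 - (w i).2)}.indicator
            (fun w => Set.indicator {p : V3 × V3 | (C * Real.sqrt (Real.log ((N : ℝ) + 2))) ^ 2 <
                ‖p.1‖ ^ 2 + ‖p.2‖ ^ 2} (fun _ => (1 : ℝ≥0∞)) ((w i).2, (w j).2))
            ((Φ N).flow ((k : ℝ) * (t / M)) z) else 0)) ∂(localGibbsLaw σ a₀ u₀ θ₀ N (Φ N))) atTop ≤ B N) :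
    ∃ C' : ℝ, 0 ≤ C' ∧
      ∃ g : (N : ℕ) → Config (N + 1) (Fin 3) T3 → ℝ≥0∞, (∀ N, Measurable (g N)) ∧
        (∀ N, ∀ z ∈ (Φ N).good,
          ((Set.ncard {r ∈ Set.Ioc 0 t | ∃ i j : Fin (N + 1), i ≠ j ∧
              (Φ N).flow r z ∈ contactSet (Torus.geometry (Fin 3)) (N + 1) (hsDiameter σ N) i j ∧
              (C' * Real.sqrt (Real.log ((N : ℝ) + 2))) ^ 2 <
                ‖((Φ N).flow r z i).2‖ ^ 2 + ‖((Φ N).flow r z j).2‖ ^ 2} : ℕ) : ℝ≥0∞) ≤ g N z) ∧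
        Tendsto (fun N : ℕ => ∫⁻ z, g N z ∂(localGibbsLaw σ a₀ u₀ θ₀ N (Φ N))) atTop (𝓝 0) := by
  set c : ℕ → ℝ := fun N => C * Real.sqrt (Real.log ((N : ℝ) + 2)) with hc
  set g : (N : ℕ) → Config (N + 1) (Fin 3) T3 → ℝ≥0∞ := fun N =>
    (Φ N).good.indicator (eventSum (Φ N) 0 t {q : VelEvent | c N ^ 2 < ‖q.2.1‖ ^ 2 + ‖q.2.2‖ ^ 2})
    with hg
  refine ⟨C, hC, g, fun N => ?_, fun N z hz => ?_, ?_⟩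
  · exact censusLedger_eventMeasurable σ hσ hσ2 N (Φ N) 0 t _ (measurableSet_energeticEvent (c N))
  · simp only [hg, indicator_of_mem hz]
    exact ncard_energetic_le_eventSum hσ hσ2 (Φ N) hz (c N) t
  · have hle : ∀ N, ∫⁻ z, g N z ∂(localGibbsLaw σ a₀ u₀ θ₀ N (Φ N)) ≤ B N := fun N =>
      (lintegral_indicator_eventSum_le_liminf_windowSum hσ a₀ θ₀ u₀ (Φ N) ht (c N) (S N)
        (hSm N) (hS N)).trans (hwin N)
    exact tendsto_of_tendsto_of_tendsto_of_le_of_le tendsto_const_nhds hB (fun _ => bot_le) hle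

/-! ## The registered stub 3a of the line, by name and signature -/

/-- **Registered stub `stub_energeticCollisionsRare_of_windowBound` of the line `registered` (birth
skeleton, cycle-2 reshape) of the crux `MaxSpeedBoundLog` (stmt-AtomisticToContinuum-9629), by name
and signature**: the data of the dynamic statement `EnergeticCollisionsRare` at `(σ, t, Φ)` —
`C' ≥ 0`, measurable majorants of the energetic-collision count on good orbits, vanishing local-Gibbs
mean — from vanishing time-Riemann sums of fixed-time one-window energetic pair events
(`energeticCollisionsRare_data_of_windowBound`, with `C' = C`). -/
theorem stub_energeticCollisionsRare_of_windowBound :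
    ∀ (σ : ℝ), 0 < σ → σ < 1 / 2 →
      ∀ (a₀ θ₀ : Literature.MathematicalPhysics.KineticTheory.T3 → ℝ)
        (u₀ : Literature.MathematicalPhysics.KineticTheory.T3 → Literature.MathematicalPhysics.KineticTheory.V3)
        (t : ℝ), 0 < t →
      ∀ (Φ : (N : ℕ) → Literature.Analysis.FluidPDE.HardSphereFlow
          (Literature.Analysis.FluidPDE.Torus.geometry (Fin 3))
          (Literature.MathematicalPhysics.KineticTheory.hsDiameter σ N) (N + 1)) (C : ℝ), 0 ≤ C →
      ∀ S : ℕ → ℕ → Literature.MathematicalPhysics.KineticTheory.V3 → Set Literature.MathematicalPhysics.KineticTheory.V3,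
        (∀ N M, MeasurableSet {q : Literature.MathematicalPhysics.KineticTheory.V3 ×
          Literature.MathematicalPhysics.KineticTheory.V3 | q.1 ∈ S N M q.2}) →
        (∀ (N M : ℕ) (u r : Literature.MathematicalPhysics.KineticTheory.V3) (s : ℝ),
          Literature.MathematicalPhysics.KineticTheory.hsDiameter σ N ≤ ‖r‖ → s ∈ Set.Icc 0 (t / M) →
          ‖r + s • u‖ = Literature.MathematicalPhysics.KineticTheory.hsDiameter σ N → r ∈ S N M u) →
      ∀ B : ℕ → ℝ≥0∞, Filter.Tendsto B Filter.atTop (nhds 0) →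
        (∀ N : ℕ, Filter.liminf (fun M : ℕ => ∑ k ∈ Finset.Icc 1 M,
          ∫⁻ z, (∑ i : Fin (N + 1), ∑ j : Fin (N + 1), (if i ≠ j then
            {w : Literature.Analysis.FluidPDE.Config (N + 1) (Fin 3) Literature.MathematicalPhysics.KineticTheory.T3 |
                ∃ k : Fin 3 → ℤ, Literature.Analysis.FluidPDE.Torus.reprSym ((w i).1 - (w j).1) +
                  Literature.Analysis.FunctionSpaces.Torus.latticeVec k ∈ S N M ((w j).2 - (w i).2)}.indicator
              (fun w => Set.indicator {p : Literature.MathematicalPhysics.KineticTheory.V3 ×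
                  Literature.MathematicalPhysics.KineticTheory.V3 |
                  (C * Real.sqrt (Real.log ((N : ℝ) + 2))) ^ 2 < ‖p.1‖ ^ 2 + ‖p.2‖ ^ 2}
                (fun _ => (1 : ℝ≥0∞)) ((w i).2, (w j).2))
              ((Φ N).flow ((k : ℝ) * (t / M)) z) else 0))
            ∂(Literature.MathematicalPhysics.KineticTheory.localGibbsLaw σ a₀ u₀ θ₀ N (Φ N))) Filter.atTop ≤ B N) →
      ∃ C' : ℝ, 0 ≤ C' ∧
      ∃ g : (N : ℕ) → Literature.Analysis.FluidPDE.Config (N + 1) (Fin 3) Literature.MathematicalPhysics.KineticTheory.T3 → ℝ≥0∞,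
        (∀ N, Measurable (g N)) ∧
        (∀ N, ∀ z ∈ (Φ N).good,
          ((Set.ncard {r ∈ Set.Ioc 0 t | ∃ i j : Fin (N + 1), i ≠ j ∧
              (Φ N).flow r z ∈ Literature.Analysis.FluidPDE.contactSet
                  (Literature.Analysis.FluidPDE.Torus.geometry (Fin 3)) (N + 1)
                  (Literature.MathematicalPhysics.KineticTheory.hsDiameter σ N) i j ∧
              (C' * Real.sqrt (Real.log ((N : ℝ) + 2))) ^ 2 <
                ‖((Φ N).flow r z i).2‖ ^ 2 + ‖((Φ N).flow r z j).2‖ ^ 2} : ℕ) : ℝ≥0∞) ≤ g N z) ∧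
        Filter.Tendsto (fun N : ℕ => ∫⁻ z, g N z ∂(Literature.MathematicalPhysics.KineticTheory.localGibbsLaw σ a₀ u₀ θ₀ N (Φ N)))
          Filter.atTop (nhds 0) :=
  fun _σ hσ hσ2 a₀ θ₀ u₀ _t ht Φ _C hC S hSm hS B hB hwin =>
    energeticCollisionsRare_data_of_windowBound hσ hσ2 a₀ θ₀ u₀ ht Φ hC S hSm hS B hB hwin

end Summit.AtomisticToContinuum.HydrodynamicLimit.Theorems.MaxSpeedBoundLogLine

end
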